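import Summits.ABC.ABC.Theses.CubicResolventAllowance
import Literature.NumberTheory.DiophantineGeometry.SubexponentialSzpiroFamilies
import HarnessLib

/-!
# STUB-IDEAS `stub_complexCubic` · ideator k1 · gen 13 — FAMILY 1 import: Cuevas Barrientos–Pasten 2025
# on the simplest fixed-field pencil (the in-print CEILING on the route's kill family)

Crux stmt-ABC-22740 `CubicResolventAllowance.IndexSzpiro`; stub = the `d_K < 0` half (verbatim below).
Companion of `STUB-IDEAS-stub_complexCubic-1.md` (gen 13). Earlier k1 sketches BY REFERENCE
(G3 Mersenne calibration `A6_…`, G5 keystone `K5/K6/K7b`, G6 `stub_of_szpiro` / `abcWithExponent_eight_of_stub`,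
G11 `DepthGradedSzpiro`). New here, all over EXISTING declarations:

* the `ℚ(∛2)`-Tschirnhaus pencil `P_n : y² = x³ − 6n·x − (4n³ + 2)` (`n ∈ ℤ`) = the Cuevas–Pasten fibre with
  `A = −6X`, `B = −(4X³ + 2)`: every fibre has the 2-division abscissa `η_n = θ + nθ²` (`θ³ = 2`), so its
  2-division field is the FIXED complex cubic field `ℚ(∛2)` (`d_K = −108`), and `Δ(P_n) = −1728·(2n³ − 1)²`
  (it is the `y = 1` line of the gen-6 pencil: the Frey-like curve of `1 + (2n³ − 1) = 2n³`);
* H4: the IMPORT — `CuevasPasten2025_thm_1_1` (arXiv:2504.15971 Thm 1.1, a theorem in print, NAMED FACT in the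
  tree) gives `h(P_n) ≤ C(ε)·N(P_n)^ε` on the pencil (Cor 1.2, PROVED in the tree from the fact): SUBEXPONENTIAL
  Szpiro on a kill-criterion family of the route, the strongest importable statement there;
* H5 (statement): the stub restricted to the pencil is the POLYNOMIAL radical bound
  `|2n³ − 1| ≤ C(ε)·rad(2n³ − 1)^{3+ε}` for all `n` — open (one third of Langevin's `abc ⇒ rad f(n) ≫ n^{deg f−1−ε}`;
  in print only `rad ≥ exp(κ (log₂ n)²/log₃ n)`, arXiv:2504.15971 Thm 1.3 for `f(m) = m³ − 4`, `m = 2n`).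
Nothing here is claimed toward the stub itself: verdict `open-problem` (13 generations).
-/

set_option linter.dupNamespace false

noncomputable section

namespace Summit.ABC.ABC.Cruxes.IndexSzpiro.StubIdeasComplexCubic1G13

open Polynomial WeierstrassCurve UniqueFactorizationMonoid
open Literature.NumberTheory.DiophantineGeometry

/-- The stub, verbatim (payload `stub.signature`). -/
def Stub : Prop :=
  ∀ ε : ℝ, 0 < ε → ∃ C : ℝ, ∀ (W : WeierstrassCurve ℚ) [W.IsElliptic] (K : Type) [Field K] [NumberField K],
    Irreducible W.twoTorsionPolynomial.toPoly → Module.finrank ℚ K = 3 →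
    (∃ θ : K, aeval θ W.twoTorsionPolynomial.toPoly = 0) → NumberField.discr K < 0 →
    (W.minimalDiscriminantNorm ℤ : ℝ) ≤ C * |(NumberField.discr K : ℝ)| * (W.conductorNorm ℤ : ℝ) ^ (6 + ε)

/-- Plumbing (kernel-checked): the route crux gives the stub. [folklore] -/
theorem stub_of_indexSzpiro (h : Summit.ABC.ABC.Theses.CubicResolventAllowance.IndexSzpiro) : Stub := by
  intro ε hε
  obtain ⟨C, hC⟩ := h ε hε
  exact ⟨C, fun W _ K _ _ hirr h3 hθ _ => hC W K hirr h3 hθ⟩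

/-! ### H1 — the `ℚ(∛2)`-Tschirnhaus pencil as a Cuevas–Pasten fibre -/

/-- `A = −6X`. -/
def cbrtTwoA : ℤ[X] := -6 * X

/-- `B = −(4X³ + 2)`. -/
def cbrtTwoB : ℤ[X] := -(4 * X ^ 3 + 2)

/-- The pencil `P_n : y² = x³ − 6n x − (4n³ + 2)` over `ℚ` (a Cuevas–Pasten fibre by construction). -/
abbrev pencil (n : ℤ) : WeierstrassCurve ℚ := cuevasPastenFibre cbrtTwoA cbrtTwoB n

/-- H1a (S, kernel-checked): `a₄(P_n) = −6n`. [folklore] -/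
theorem pencil_a₄ (n : ℤ) : (pencil n).a₄ = -6 * (n : ℚ) := by
  rw [cuevasPastenFibre_a₄]
  simp [cbrtTwoA]

/-- H1b (S, kernel-checked): `a₆(P_n) = −(4n³ + 2)`. [folklore] -/
theorem pencil_a₆ (n : ℤ) : (pencil n).a₆ = -(4 * (n : ℚ) ^ 3 + 2) := by
  rw [cuevasPastenFibre_a₆]
  simp [cbrtTwoB]

/-- H1c (S, kernel-checked): `Δ(P_n) = −1728·(2n³ − 1)²` — in particular `Δ < 0` on every fibre and the
only bad primes `≥ 5` are the primes of `2n³ − 1` (where `c₄ = 288n` is a unit: multiplicative reduction). [folklore] -/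
theorem pencil_Δ (n : ℤ) : (pencil n).Δ = -1728 * (2 * (n : ℚ) ^ 3 - 1) ^ 2 := by
  rw [cuevasPastenFibre_Δ]
  simp [cbrtTwoA, cbrtTwoB]
  ring

/-- H1d (S, kernel-checked): `c₄(P_n) = 288 n`. [folklore] -/
theorem pencil_c₄ (n : ℤ) : (pencil n).c₄ = 288 * (n : ℚ) := by
  simp only [WeierstrassCurve.c₄, WeierstrassCurve.b₂, WeierstrassCurve.b₄, cuevasPastenFibre]
  simp [cbrtTwoA]
  ring

/-! ### H2 — the 2-division abscissa `η_n = θ + nθ²` lies in the fixed field `ℚ(θ)`, `θ³ = 2` -/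

/-- H2 (S, kernel-checked): for any `θ` with `θ³ = 2` (in any field of characteristic 0, e.g. `K = ℚ(∛2)`),
`η_n := θ + n θ²` is a root of the 2-division polynomial `4x³ + b₂x² + 2b₄x + b₆ = 4(x³ − 6n x − 4n³ − 2)` of `P_n`:
`η³ = 2 + 4n³ + 6n·η`. Hence the 2-division field of every fibre is `ℚ(∛2)` (η ∉ ℚ as `1, θ, θ²` are independent). [folklore] -/
theorem pencil_twoTorsion_root (K : Type*) [Field K] [CharZero K] [Algebra ℚ K] (θ : K) (hθ : θ ^ 3 = 2) (n : ℤ) :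
    aeval (θ + (n : K) * θ ^ 2) (pencil n).twoTorsionPolynomial.toPoly = 0 := by
  simp only [WeierstrassCurve.twoTorsionPolynomial, Cubic.toPoly, WeierstrassCurve.b₂, WeierstrassCurve.b₄,
    WeierstrassCurve.b₆, cuevasPastenFibre, map_add, map_mul, aeval_C, aeval_X, map_pow]
  simp [cbrtTwoA, cbrtTwoB]
  linear_combination (4 : K) * ((n : K) ^ 3 * θ ^ 3 + 3 * (n : K) ^ 2 * θ ^ 2 + 3 * (n : K) * θ + 1 + 2 * (n : K) ^ 3) * hθ

/-! ### H3 — the Cuevas–Pasten hypotheses for `(A, B) = (−6X, −(4X³+2))` -/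

/-- H3a (S): `A`, `B` are coprime in `ℚ[X]` (Bezout: `(X²/3)·A − ½·B = 1`). [folklore] -/
theorem pencil_isCoprime :
    IsCoprime (cbrtTwoA.map (Int.castRingHom ℚ)) (cbrtTwoB.map (Int.castRingHom ℚ)) := by
  refine ⟨C (1 / 3 : ℚ) * X ^ 2, C (-1 / 2 : ℚ), ?_⟩
  simp only [cbrtTwoA, cbrtTwoB, Polynomial.map_mul, Polynomial.map_neg, Polynomial.map_add,
    Polynomial.map_pow, Polynomial.map_X, Polynomial.map_ofNat]
  have h1 : C (1 / 3 : ℚ) * (6 : ℚ[X]) = 2 := by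
    rw [← map_ofNat C 6, ← map_mul]; norm_num [map_ofNat]
  have h2 : C (-1 / 2 : ℚ) * (2 : ℚ[X]) = -1 := by
    rw [← map_ofNat C 2, ← map_mul]; norm_num [map_ofNat]
  have h3 : C (-1 / 2 : ℚ) * (4 : ℚ[X]) = -2 := by
    rw [← map_ofNat C 4, ← map_mul]; norm_num [map_ofNat]
  linear_combination (-X ^ 3) * h1 + (-X ^ 3) * h3 + (-1 : ℚ[X]) * h2

/-- H3b (S, kernel-checked): `A` is non-constant. [folklore] -/
theorem pencil_natDegree_pos : 0 < cbrtTwoA.natDegree ∨ 0 < cbrtTwoB.natDegree := by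
  left
  have : cbrtTwoA = C (-6 : ℤ) * X := by simp [cbrtTwoA]
  rw [this, Polynomial.natDegree_C_mul_X _ (by norm_num)]
  exact Nat.one_pos

/-- H3c (S): `4A³ + 27B² = 108·(2X³ − 1)² ≠ 0`. [folklore] -/
theorem pencil_disc_ne_zero : 4 * cbrtTwoA ^ 3 + 27 * cbrtTwoB ^ 2 ≠ 0 := by
  have h : 4 * cbrtTwoA ^ 3 + 27 * cbrtTwoB ^ 2 = C (108 : ℤ) * (2 * X ^ 3 - 1) ^ 2 := by
    simp only [cbrtTwoA, cbrtTwoB, map_ofNat]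
    ring
  rw [h]
  refine mul_ne_zero (by simp) (pow_ne_zero _ ?_)
  intro h0
  have h1 := congrArg (Polynomial.eval 0) h0
  simp at h1

/-! ### H4 — the IMPORT: subexponential Szpiro (height form) on the pencil, from the named fact -/

/-- H4 (S, kernel-checked modulo H3a/H3c): **Cuevas Barrientos–Pasten 2025, Cor 1.2 on the `ℚ(∛2)` pencil** —
`h(P_n) ≤ C(ε)·N(P_n)^ε` for every `ε > 0` and every elliptic fibre. Subexponential, NOT polynomial: it does not
give the stub on the pencil (which needs `log|Δ_min| ≤ (6+ε) log N + O(1)`), and it is the strongest statement in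
print on this kill-criterion family. [cite: CuevasPasten2025SubexpSzpiro, Thm 1.1, Cor 1.2] -/
theorem pencil_subexp_height (h : CuevasPasten2025_thm_1_1) {ε : ℝ} (hε : 0 < ε) :
    ∃ C : ℝ, ∀ (n : ℤ) [(pencil n).IsElliptic],
      (pencil n).faltingsHeight ≤ C * ((pencil n).conductorNorm ℤ : ℝ) ^ ε :=
  CuevasPasten2025_thm_1_1.cor_1_2 h cbrtTwoA cbrtTwoB pencil_isCoprime pencil_natDegree_pos
    pencil_disc_ne_zero hε

/-! ### H5 — what the stub SAYS on the pencil: a polynomial radical bound for the values of `2n³ − 1` -/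

/-- The cubic-value radical bound `|2n³ − 1| ≤ C(ε)·rad(2n³ − 1)^{3+ε}` (all `n ∈ ℤ`): one third of Langevin's
conditional exponent; OPEN; in print only subexponential lower bounds for `rad` (arXiv:2504.15971 Thm 1.3). -/
def CubicValueRadicalBound : Prop :=
  ∀ ε : ℝ, 0 < ε → ∃ C : ℝ, ∀ n : ℤ,
    (((2 * n ^ 3 - 1).natAbs : ℕ) : ℝ) ≤ C * (radical (M := ℕ) (2 * n ^ 3 - 1).natAbs : ℝ) ^ (3 + ε)

/-- H5 (M, CALIBRATION for `Disproof.lean`, polynomial sibling of G3 `A6_radical_mersenne_ge_of_stub`):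
the stub, applied to the pencil with `K = ℚ(∛2)` (`d_K = −108 < 0`, `ψ₂(P_n)` irreducible, H2 root), gives
`CubicValueRadicalBound`: at `p ∤ 6`, `p ∣ 2n³ − 1` the fibre is multiplicative (`c₄ = 288n` a `p`-unit, H1d) so
`v_p(Δ_min) = 2·v_p(2n³ − 1)`, `v_p(N) = 1`; primes of `n` are good; `2, 3` contribute bounded factors
(`|Δ_min| ≥ (2n³−1)²/2¹²3¹²`-type, `N ∣ 2⁸3⁵·rad(2n³ − 1)`). Typed with the field data as hypotheses. [folklore] -/
theorem cubicValueRadicalBound_of_stub (h : Stub)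
    (K : Type) [Field K] [NumberField K] (hK : Module.finrank ℚ K = 3) (hd : NumberField.discr K < 0)
    (θ : K) (hθ : θ ^ 3 = 2) : CubicValueRadicalBound := by
  sorry

end Summit.ABC.ABC.Cruxes.IndexSzpiro.StubIdeasComplexCubic1G13

end
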